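import Literature.Analysis.PDE.FlatLocalResidual
import Literature.Analysis.PDE.LatticePatches
import Literature.Analysis.PDE.SobolevLinearTransport
import HarnessLib

/-!
# One step of the flat fine parametrix: framed lattice patches, local solves, covariance,
# and the residual identity of the assembled approximate solution (topic `Analysis/PDE`)

Fine level of the parametrix (layer (I') of the programme to prove short-time existence for
quasilinear strictly parabolic systems on a closed manifold, hypothesis `hQL` of
`Literature.Geometry.Riemannian.ricciFlow_shortTime_existence_of_quasilinear`). Setting: a flat
patch family `Q` in a Euclidean space `E'` (`LatticePatches.lean`), frames `A i : E' ≃L E'`,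
coefficient fields `S, 𝔟, 𝔠` of the operator `L u y = frameOp (S t y) (𝔟 t y) (𝔠 t y) u y` on the
slab, and slab data `Θ` supported in the region of `Q`. For each patch the data `ρ_i Θ` are pulled
back to ADAPTED affine coordinates `y = Ψ_i z = (A i)⁻¹ z + c_i`, solved by the flat Duhamel
solution (`flatLocalSol`), cut off and pushed forward; the sum `vOne` of the pieces satisfies

  `∂ₜ vOne = L vOne + Θ - errOne`  on the slab (`timeDerivWithin_vOne`),

where `errOne` is the sum of the pushed-forward flat local residuals (`FlatLocalResidual.lean`).
Main ingredients: the covariance of the operator under the adapted affine maps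
(`frameOp_adapted`, from `frameOp_comp_affine`), the flat residual identity of each piece, and
the partition of unity. The contraction estimate for `errOne` is the object of `FlatStepEnergy`.

Everything is proved; no named fact and no `sorry` is introduced.

## References

* L. Hörmander, *The Analysis of Linear Partial Differential Operators III*, Springer 1985,
  §17.1 (local parametrices by freezing and patching). [Hormander1985III]
-/

noncomputable section

open Set Function Filter Topology Metric MeasureTheory InnerProductSpace
open scoped ContDiff Topology ENNReal RealInnerProductSpace Laplacian

namespace Literature.Analysis.PDE

open Literature.Analysis.FunctionSpaces Literature.Analysis.FluidPDE

variable {E' : Type*} [NormedAddCommGroup E'] [InnerProductSpace ℝ E'] [FiniteDimensional ℝ E']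
variable {F' : Type*} [NormedAddCommGroup F'] [InnerProductSpace ℝ F']

/-! ### Covariance of the operator under adapted affine maps -/

omit [FiniteDimensional ℝ E'] in
/-- Precomposition operators compose contravariantly. [folklore] -/
theorem precompCLM_comp_precompCLM (M N : E' →L[ℝ] E') :
    (precompCLM (F := F') M) ∘L precompCLM N = precompCLM (N ∘L M) := by
  ext P x
  simp [ContinuousLinearMap.comp_apply, precompCLM_apply]

/-- **Covariance**: with `S̃ = A S A†`, `𝔟̃ = 𝔟 ∘ precomp A`, `𝔠̃ = 𝔠` and `ũ z = u (A⁻¹ z + c)`,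
`frameOp S̃ 𝔟̃ 𝔠̃ ũ z = frameOp S 𝔟 𝔠 u (A⁻¹ z + c)`. [cite: Hormander1985III, §17.1] -/
theorem frameOp_adapted (Ai : E' ≃L[ℝ] E') (c : E') (S₀ : E' →L[ℝ] E') (𝔟₀ : (E' →L[ℝ] F') →L[ℝ] F')
    (𝔠₀ : F' →L[ℝ] F') {u : E' → F'} (hu : ContDiff ℝ 2 u) (z : E') :
    frameOp ((Ai : E' →L[ℝ] E') ∘L S₀ ∘L ContinuousLinearMap.adjoint (Ai : E' →L[ℝ] E'))
      (𝔟₀ ∘L precompCLM (Ai : E' →L[ℝ] E')) 𝔠₀ (fun z ↦ u (Ai.symm z + c)) z =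
      frameOp S₀ 𝔟₀ 𝔠₀ u (Ai.symm z + c) := by
  rw [frameOp_comp_affine Ai.symm c _ _ _ hu z]
  congr 1
  · -- `A⁻¹ (A S A†) (A⁻¹)† = S`
    have h1 : (Ai.symm : E' →L[ℝ] E') ∘L (Ai : E' →L[ℝ] E') = ContinuousLinearMap.id ℝ E' := Ai.coe_symm_comp_coe
    have h2 : ContinuousLinearMap.adjoint (Ai : E' →L[ℝ] E') ∘L ContinuousLinearMap.adjoint (Ai.symm : E' →L[ℝ] E') =
        ContinuousLinearMap.id ℝ E' := by
      rw [← ContinuousLinearMap.adjoint_comp, h1]; simp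
    calc (Ai.symm : E' →L[ℝ] E') ∘L ((Ai : E' →L[ℝ] E') ∘L S₀ ∘L ContinuousLinearMap.adjoint (Ai : E' →L[ℝ] E')) ∘L
          ContinuousLinearMap.adjoint (Ai.symm : E' →L[ℝ] E')
        = ((Ai.symm : E' →L[ℝ] E') ∘L (Ai : E' →L[ℝ] E')) ∘L S₀ ∘L
          (ContinuousLinearMap.adjoint (Ai : E' →L[ℝ] E') ∘L ContinuousLinearMap.adjoint (Ai.symm : E' →L[ℝ] E')) := by
          simp only [ContinuousLinearMap.comp_assoc]
      _ = S₀ := by rw [h1, h2]; simp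
  · -- `(𝔟 ∘ precomp A) ∘ precomp A⁻¹ = 𝔟`
    rw [ContinuousLinearMap.comp_assoc, precompCLM_comp_precompCLM]
    have h1 : (Ai.symm : E' →L[ℝ] E') ∘L (Ai : E' →L[ℝ] E') = ContinuousLinearMap.id ℝ E' := Ai.coe_symm_comp_coe
    rw [h1]
    ext P
    simp [precompCLM_apply]

/-! ### The objects of one step -/

namespace FlatStep

variable {ι : Type*} [Fintype ι] (Q : FlatPatches E' ι) (A : ι → E' ≃L[ℝ] E') (T : ℝ)
  (S : ℝ → E' → (E' →L[ℝ] E')) (𝔟 : ℝ → E' → ((E' →L[ℝ] F') →L[ℝ] F')) (𝔠 : ℝ → E' → (F' →L[ℝ] F'))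
  (Θ : ℝ → E' → F')

/-- The adapted affine map of patch `i`: `Ψ_i z = (A i)⁻¹ z + c_i`. [folklore] -/
def psi (i : ι) (z : E') : E' := (A i).symm z + Q.c i

/-- Its inverse: `Ψ_i⁻¹ y = A i (y - c_i)`. [folklore] -/
def psiInv (i : ι) (y : E') : E' := A i (y - Q.c i)

omit [FiniteDimensional ℝ E'] in
/-- `psi_psiInv`: psi psiInv. [folklore] -/
@[simp] theorem psi_psiInv (i : ι) (y : E') : psi Q A i (psiInv Q A i y) = y := by
  simp [psi, psiInv]

omit [FiniteDimensional ℝ E'] in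
/-- `psiInv_psi`: psiInv psi. [folklore] -/
@[simp] theorem psiInv_psi (i : ι) (z : E') : psiInv Q A i (psi Q A i z) = z := by
  simp [psi, psiInv]

/-- The adapted symbol slice of patch `i`. [folklore] -/
def Sad (i : ι) (s : ℝ) (z : E') : E' →L[ℝ] E' :=
  (A i : E' →L[ℝ] E') ∘L S s (psi Q A i z) ∘L ContinuousLinearMap.adjoint (A i : E' →L[ℝ] E')

/-- The adapted first-order coefficient slice of patch `i`. [folklore] -/
def Bad (i : ι) (s : ℝ) (z : E') : (E' →L[ℝ] F') →L[ℝ] F' := 𝔟 s (psi Q A i z) ∘L precompCLM (A i : E' →L[ℝ] E')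

/-- The adapted zeroth-order coefficient slice of patch `i`. [folklore] -/
def Cad (i : ι) (s : ℝ) (z : E') : F' →L[ℝ] F' := 𝔠 s (psi Q A i z)

/-- The pulled-back localised data of patch `i`: `Θ̃_i(s, z) = ρ_i(Ψ_i z) Θ(s, Ψ_i z)`. [folklore] -/
def dataAd (i : ι) (s : ℝ) (z : E') : F' := Q.ρ i (psi Q A i z) • Θ s (psi Q A i z)

/-- The pulled-back cut-off of patch `i`. [folklore] -/
def cutAd (i : ι) (z : E') : ℝ := Q.cut i (psi Q A i z)

/-- The pulled-back outer cut-off of patch `i`. [folklore] -/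
def cutPAd (i : ι) (z : E') : ℝ := Q.cutPlus i (psi Q A i z)

/-- The local heat solution of patch `i` in adapted coordinates. [folklore] -/
def wAd [MeasurableSpace E'] [BorelSpace E'] [FiniteDimensional ℝ F'] (i : ι) : ℝ → E' → F' :=
  flatLocalSol T (dataAd Q A Θ i)

/-- The cut-off local solution in adapted coordinates `ṽ_i = cut̃_i • w̃_i`. [folklore] -/
def vAd [MeasurableSpace E'] [BorelSpace E'] [FiniteDimensional ℝ F'] (i : ι) (s : ℝ) (z : E') : F' :=
  cutAd Q A i z • wAd Q A T Θ i s z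

/-- The pushed-forward piece of patch `i`: `v_i(s, y) = ṽ_i(s, Ψ_i⁻¹ y)`. [folklore] -/
def vPiece [MeasurableSpace E'] [BorelSpace E'] [FiniteDimensional ℝ F'] (i : ι) (s : ℝ) (y : E') : F' :=
  vAd Q A T Θ i s (psiInv Q A i y)

/-- The local residual of patch `i` in adapted coordinates. [folklore] -/
def errAd [MeasurableSpace E'] [BorelSpace E'] [FiniteDimensional ℝ F'] (i : ι) (s : ℝ) : E' → F' :=
  flatErr (Sad Q A S i s) (Bad Q A 𝔟 i s) (Cad Q A 𝔠 i s) (cutAd Q A i) (wAd Q A T Θ i s)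

/-- The pushed-forward local residual of patch `i`. [folklore] -/
def errPiece [MeasurableSpace E'] [BorelSpace E'] [FiniteDimensional ℝ F'] (i : ι) (s : ℝ) (y : E') : F' :=
  errAd Q A T S 𝔟 𝔠 Θ i s (psiInv Q A i y)

/-- **The assembled approximate solution of one step.** [cite: Hormander1985III, §17.1] -/
def vOne [MeasurableSpace E'] [BorelSpace E'] [FiniteDimensional ℝ F'] (s : ℝ) (y : E') : F' :=
  ∑ i, vPiece Q A T Θ i s y

/-- **The assembled residual of one step.** [cite: Hormander1985III, §17.1] -/
def errOne [MeasurableSpace E'] [BorelSpace E'] [FiniteDimensional ℝ F'] (s : ℝ) (y : E') : F' :=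
  ∑ i, errPiece Q A T S 𝔟 𝔠 Θ i s y

/-! ### Basic properties of the objects -/

section Basic

variable {Q A T S 𝔟 𝔠 Θ}

omit [FiniteDimensional ℝ E'] in
/-- The adapted affine maps are smooth. [folklore] -/
theorem contDiff_psi (i : ι) : ContDiff ℝ ∞ (psi Q A i) :=
  ((A i).symm.contDiff).add contDiff_const

omit [FiniteDimensional ℝ E'] in
/-- The inverse adapted affine maps are smooth. [folklore] -/
theorem contDiff_psiInv (i : ι) : ContDiff ℝ ∞ (psiInv Q A i) :=
  (A i).contDiff.comp (contDiff_id.sub contDiff_const)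

omit [FiniteDimensional ℝ E'] in
/-- Composition of a slab-smooth field with a smooth map in space is slab-smooth. [folklore] -/
theorem _root_.Literature.Analysis.FluidPDE.IsSmoothSpaceTimeOn.comp_space {G : Type*} [NormedAddCommGroup G]
    [NormedSpace ℝ G] {X : Type*} [NormedAddCommGroup X] [NormedSpace ℝ X] {Sset : Set ℝ} {w : ℝ → E' → G}
    (hw : IsSmoothSpaceTimeOn Sset w) {φ : X → E'} (hφ : ContDiff ℝ ∞ φ) :
    IsSmoothSpaceTimeOn Sset fun s x ↦ w s (φ x) := by
  have h : ContDiffOn ℝ ∞ (fun q : ℝ × X ↦ ((q.1, φ q.2) : ℝ × E')) (Sset ×ˢ univ) :=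
    (contDiff_fst.prodMk (hφ.comp contDiff_snd)).contDiffOn
  have := hw.comp h fun q hq ↦ mk_mem_prod (mem_prod.1 hq).1 (mem_univ _)
  exact this

omit [FiniteDimensional ℝ E'] in
/-- The pulled-back localised data are slab-smooth. [folklore] -/
theorem isSmoothSpaceTimeOn_dataAd (hΘ : IsSmoothSpaceTimeOn (Icc 0 T) Θ) (i : ι) :
    IsSmoothSpaceTimeOn (Icc 0 T) (dataAd Q A Θ i) :=
  (isSmoothSpaceTimeOn_const_time ((Q.ρ_smooth i).comp (contDiff_psi i)) _).smul (hΘ.comp_space (contDiff_psi i))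

/-- The compact spatial support of the pulled-back data of patch `i`. [folklore] -/
theorem isCompact_supportAd (i : ι) : IsCompact (psiInv Q A i '' closedBall (Q.c i) (2 * Q.r)) :=
  (isCompact_closedBall _ _).image (contDiff_psiInv i).continuous

omit [FiniteDimensional ℝ E'] in
/-- The pulled-back data vanish off their compact support set. [folklore] -/
theorem dataAd_eq_zero (i : ι) (s : ℝ) {z : E'} (hz : z ∉ psiInv Q A i '' closedBall (Q.c i) (2 * Q.r)) :
    dataAd Q A Θ i s z = 0 := by
  have hy : psi Q A i z ∉ closedBall (Q.c i) (2 * Q.r) := fun h ↦ hz ⟨psi Q A i z, h, psiInv_psi Q A i z⟩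
  have h0 : Q.ρ i (psi Q A i z) = 0 :=
    image_eq_zero_of_notMem_tsupport fun h ↦ hy (ball_subset_closedBall (Q.tsupport_ρ i h))
  simp [dataAd, h0]

/-- The pulled-back cut-off is smooth. [folklore] -/
theorem contDiff_cutAd (i : ι) : ContDiff ℝ ∞ (cutAd Q A i) := (Q.cut i).contDiff.comp (contDiff_psi i)

/-- The pulled-back outer cut-off is smooth. [folklore] -/
theorem contDiff_cutPAd (i : ι) : ContDiff ℝ ∞ (cutPAd Q A i) := (Q.cutPlus i).contDiff.comp (contDiff_psi i)

/-- `cutP̃ = 1` on `tsupport cut̃`. [folklore] -/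
theorem cutPAd_eq_one (i : ι) {z : E'} (hz : z ∈ tsupport (cutAd Q A i)) : cutPAd Q A i z = 1 := by
  have h := tsupport_comp_subset_preimage (Q.cut i : E' → ℝ) (f := psi Q A i) (contDiff_psi i).continuous hz
  exact Q.cutPlus_eq_one_of_mem_tsupport_cut i h

/-- `|cut̃| ≤ 1`. [folklore] -/
theorem abs_cutAd_le_one (i : ι) (z : E') : |cutAd Q A i z| ≤ 1 := by
  rw [cutAd, abs_of_nonneg (Q.cut i).nonneg]
  exact (Q.cut i).le_one

variable [MeasurableSpace E'] [BorelSpace E'] [FiniteDimensional ℝ F']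

/-- The cut-off local solutions are slab-smooth. [folklore] -/
theorem isSmoothSpaceTimeOn_vAd (hT : 0 < T) (hΘ : IsSmoothSpaceTimeOn (Icc 0 T) Θ) (i : ι) :
    IsSmoothSpaceTimeOn (Icc 0 T) (vAd Q A T Θ i) :=
  isSmoothSpaceTimeOn_cut_smul_flatLocalSol hT (isSmoothSpaceTimeOn_dataAd hΘ i) (isCompact_supportAd i)
    (dataAd_eq_zero i) (contDiff_cutAd i)

/-- The pushed-forward pieces are slab-smooth. [folklore] -/
theorem isSmoothSpaceTimeOn_vPiece (hT : 0 < T) (hΘ : IsSmoothSpaceTimeOn (Icc 0 T) Θ) (i : ι) :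
    IsSmoothSpaceTimeOn (Icc 0 T) (vPiece Q A T Θ i) :=
  (isSmoothSpaceTimeOn_vAd hT hΘ i).comp_space (contDiff_psiInv i)

/-- The slices of the pushed-forward pieces are smooth. [folklore] -/
theorem contDiff_vPiece (hT : 0 < T) (hΘ : IsSmoothSpaceTimeOn (Icc 0 T) Θ) (i : ι) {s : ℝ} (hs : s ∈ Icc 0 T) :
    ContDiff ℝ ∞ (vPiece Q A T Θ i s) :=
  (isSmoothSpaceTimeOn_vPiece hT hΘ i).contDiff_slice hs

/-- The assembled approximate solution is slab-smooth. [folklore] -/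
theorem isSmoothSpaceTimeOn_vOne (hT : 0 < T) (hΘ : IsSmoothSpaceTimeOn (Icc 0 T) Θ) :
    IsSmoothSpaceTimeOn (Icc 0 T) (vOne Q A T Θ) := by
  have h : ∀ i, IsSmoothSpaceTimeOn (Icc 0 T) (vPiece Q A T Θ i) := fun i ↦ isSmoothSpaceTimeOn_vPiece hT hΘ i
  unfold IsSmoothSpaceTimeOn at h ⊢
  have : uncurry (vOne Q A T Θ) = fun q ↦ ∑ i, uncurry (vPiece Q A T Θ i) q := by
    funext ⟨s, y⟩; simp [vOne]
  rw [this]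
  exact ContDiffOn.sum fun i _ ↦ h i

/-- The pieces vanish at `t = 0`. [folklore] -/
theorem vPiece_zero (i : ι) (y : E') : vPiece Q A T Θ i 0 y = 0 := by
  simp [vPiece, vAd, wAd, flatLocalSol_zero]

/-- The assembled approximate solution vanishes at `t = 0`. [folklore] -/
theorem vOne_zero (y : E') : vOne Q A T Θ 0 y = 0 := by
  simp [vOne, vPiece_zero]

/-! ### The residual identity -/

omit [MeasurableSpace E'] [BorelSpace E'] [FiniteDimensional ℝ F'] in
/-- **Additivity of the operator in the function** (smooth summands). [folklore] -/
theorem frameOp_sum (S₀ : E' →L[ℝ] E') (𝔟₀ : (E' →L[ℝ] F') →L[ℝ] F') (𝔠₀ : F' →L[ℝ] F') {u : ι → E' → F'}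
    (hu : ∀ i, ContDiff ℝ ∞ (u i)) (y : E') :
    frameOp S₀ 𝔟₀ 𝔠₀ (fun y ↦ ∑ i, u i y) y = ∑ i, frameOp S₀ 𝔟₀ 𝔠₀ (u i) y := by
  have hd : ∀ i, Differentiable ℝ (u i) := fun i ↦ (hu i).differentiable (by simp)
  have hd1 : ∀ i v, ContDiff ℝ ∞ fun z ↦ fderiv ℝ (u i) z v := fun i v ↦
    ((hu i).fderiv_right (m := ∞) (by norm_cast)).clm_apply contDiff_const
  have e1 : ∀ z, fderiv ℝ (fun y ↦ ∑ i, u i y) z = ∑ i, fderiv ℝ (u i) z := fun z ↦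
    fderiv_fun_sum fun i _ ↦ (hd i z)
  have e2 : ∀ v z, fderiv ℝ (fun y ↦ ∑ i, u i y) z v = ∑ i, fderiv ℝ (u i) z v := by
    intro v z; rw [e1 z]; simp
  have e3 : ∀ l k, fderiv ℝ (fun z ↦ fderiv ℝ (fun y ↦ ∑ i, u i y) z (stdOrthonormalBasis ℝ E' l)) y
      (stdOrthonormalBasis ℝ E' k) =
      ∑ i, fderiv ℝ (fun z ↦ fderiv ℝ (u i) z (stdOrthonormalBasis ℝ E' l)) y (stdOrthonormalBasis ℝ E' k) := by
    intro l k
    have hfun : (fun z ↦ fderiv ℝ (fun y ↦ ∑ i, u i y) z (stdOrthonormalBasis ℝ E' l)) =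
        fun z ↦ ∑ i, fderiv ℝ (u i) z (stdOrthonormalBasis ℝ E' l) := funext fun z ↦ e2 _ z
    rw [hfun, fderiv_fun_sum fun i _ ↦ ((hd1 i _).differentiable (by simp) y)]
    simp
  have hP : principalPart S₀ (fun y ↦ ∑ i, u i y) y = ∑ i, principalPart S₀ (u i) y := by
    simp only [principalPart_apply, e3, Finset.smul_sum]
    conv_rhs => rw [Finset.sum_comm]
    refine Finset.sum_congr rfl fun k _ ↦ ?_
    rw [Finset.sum_comm]
  rw [frameOp_apply, hP, e1, map_sum, map_sum]
  simp only [frameOp_apply, Finset.sum_add_distrib]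

/-- **The residual identity of one pushed-forward piece**: on the slab and for every `y`,
`∂ₜ v_i = L v_i + ρ_i • Θ - err_i`. [cite: Hormander1985III, §17.1] -/
theorem timeDerivWithin_vPiece (hT : 0 < T) (hΘ : IsSmoothSpaceTimeOn (Icc 0 T) Θ) (i : ι) {s : ℝ}
    (hs : s ∈ Icc 0 T) (y : E') :
    timeDerivWithin (Icc 0 T) (vPiece Q A T Θ i) s y =
      frameOp (S s y) (𝔟 s y) (𝔠 s y) (vPiece Q A T Θ i s) y + Q.ρ i y • Θ s y - errPiece Q A T S 𝔟 𝔠 Θ i s y := by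
  have hy : psi Q A i (psiInv Q A i y) = y := psi_psiInv Q A i y
  have hdata : IsSmoothSpaceTimeOn (Icc 0 T) (dataAd Q A Θ i) := isSmoothSpaceTimeOn_dataAd hΘ i
  have hK : IsCompact (psiInv Q A i '' closedBall (Q.c i) (2 * Q.r)) := isCompact_supportAd i
  have hK0 : ∀ s, ∀ z ∉ psiInv Q A i '' closedBall (Q.c i) (2 * Q.r), dataAd Q A Θ i s z = 0 := dataAd_eq_zero i
  have hcut : ContDiff ℝ ∞ (cutAd Q A i) := contDiff_cutAd i
  -- the time lines of `v_i` at `y` and of `ṽ_i` at `Ψ⁻¹ y` coincide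
  have h1 : timeDerivWithin (Icc 0 T) (vPiece Q A T Θ i) s y =
      timeDerivWithin (Icc 0 T) (fun s z ↦ cutAd Q A i z • flatLocalSol T (dataAd Q A Θ i) s z) s (psiInv Q A i y) := rfl
  rw [h1, timeDerivWithin_cut_smul_flatLocalSol_eq hT hdata hK hK0 hcut (Sad Q A S i) (Bad Q A 𝔟 i) (Cad Q A 𝔠 i) hs]
  -- covariance of the operator
  have h3 : (fun y ↦ cutAd Q A i y • flatLocalSol T (dataAd Q A Θ i) s y) =
      fun z' ↦ vPiece Q A T Θ i s ((A i).symm z' + Q.c i) := by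
    funext z'
    simp only [vPiece, vAd, wAd, cutAd]
    rw [show (A i).symm z' + Q.c i = psi Q A i z' from rfl, psiInv_psi]
  have h4 : frameOp (Sad Q A S i s (psiInv Q A i y)) (Bad Q A 𝔟 i s (psiInv Q A i y)) (Cad Q A 𝔠 i s (psiInv Q A i y))
      (fun y ↦ cutAd Q A i y • flatLocalSol T (dataAd Q A Θ i) s y) (psiInv Q A i y) =
      frameOp (S s y) (𝔟 s y) (𝔠 s y) (vPiece Q A T Θ i s) y := by
    rw [h3, Sad, Bad, Cad, frameOp_adapted (A i) (Q.c i) _ _ _ ((contDiff_vPiece hT hΘ i hs).of_le (by norm_cast))]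
    have hy' : (A i).symm (psiInv Q A i y) + Q.c i = y := hy
    simp only [hy, hy']
  -- the data term
  have h5 : cutAd Q A i (psiInv Q A i y) • dataAd Q A Θ i s (psiInv Q A i y) = Q.ρ i y • Θ s y := by
    unfold cutAd dataAd
    rw [hy]
    by_cases hρ : y ∈ tsupport (Q.ρ i)
    · rw [Q.cut_eq_one_of_mem_tsupport_ρ i hρ, one_smul]
    · rw [image_eq_zero_of_notMem_tsupport hρ, zero_smul, smul_zero]
  rw [h4, h5]
  rfl

/-- **The residual identity of the assembled approximate solution**: if the data are supported in
the region of the patch family then on the slab and for every `y`,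
`∂ₜ vOne = L vOne + Θ - errOne`. [cite: Hormander1985III, §17.1] -/
theorem timeDerivWithin_vOne (hT : 0 < T) (hΘ : IsSmoothSpaceTimeOn (Icc 0 T) Θ)
    (hΘreg : ∀ s y, Θ s y ≠ 0 → y ∈ Q.region) {s : ℝ} (hs : s ∈ Icc 0 T) (y : E') :
    timeDerivWithin (Icc 0 T) (vOne Q A T Θ) s y =
      frameOp (S s y) (𝔟 s y) (𝔠 s y) (vOne Q A T Θ s) y + Θ s y - errOne Q A T S 𝔟 𝔠 Θ s y := by
  -- time derivative of the finite sum
  have h1 : timeDerivWithin (Icc 0 T) (vOne Q A T Θ) s y = ∑ i, timeDerivWithin (Icc 0 T) (vPiece Q A T Θ i) s y := by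
    rw [timeDerivWithin_apply]
    have hfun : (fun s ↦ vOne Q A T Θ s y) = fun s ↦ ∑ i, vPiece Q A T Θ i s y := rfl
    have hdiff : ∀ i, DifferentiableWithinAt ℝ (fun s ↦ vPiece Q A T Θ i s y) (Icc 0 T) s := fun i ↦
      (isSmoothSpaceTimeOn_vPiece hT hΘ i).differentiableWithinAt_time hs y
    rw [hfun, derivWithin_fun_sum fun i _ ↦ hdiff i]
    rfl
  have key : ∀ i, timeDerivWithin (Icc 0 T) (vPiece Q A T Θ i) s y =
      frameOp (S s y) (𝔟 s y) (𝔠 s y) (vPiece Q A T Θ i s) y + Q.ρ i y • Θ s y - errPiece Q A T S 𝔟 𝔠 Θ i s y :=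
    fun i ↦ timeDerivWithin_vPiece hT hΘ i hs y
  rw [h1, Finset.sum_congr rfl fun i _ ↦ key i]
  rw [Finset.sum_sub_distrib, Finset.sum_add_distrib, ← Finset.sum_smul,
    ← frameOp_sum _ _ _ (fun i ↦ contDiff_vPiece hT hΘ i hs) y]
  -- the partition of unity on the data
  have h2 : (∑ i, Q.ρ i y) • Θ s y = Θ s y := by
    by_cases hΘ0 : Θ s y = 0
    · simp [hΘ0]
    · rw [Q.sum_ρ y (hΘreg s y hΘ0), one_smul]
  rw [h2]
  rfl

end Basic

end FlatStep

end Literature.Analysis.PDE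

end
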